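import Summits.QuantumFields.YangMills.Theses.ConvexGribovBody
import Literature.MathematicalPhysics.QuantumFieldTheory.LatticeGaugeProofs

/-!
# `PoincareToGap` — negative side: tightness of the conclusion and a constraint on the picked line

Negative-side support for crux `stmt-QuantumFields-8781`
(`Summit.QuantumFields.YangMills.Theses.ConvexGribovBody.PoincareToGap`: volume-uniform equal-time
Poincaré inequality ⟹ volume-uniform exponential time-clustering `|corr_S(A,B,n)| ≤ C e^{-m n}`,
`n ≤ S`, of all gauge-invariant local observables on the tori `(2S+1)⁴`), extracted from the
standing disprover's work file `Cruxes/PoincareToGap/Disproof.lean` (§2–§4). Nothing here asserts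
a Theses statement; every compact `G`, every `r`, every real `β`.

* `latticeConnectedCorr_add_period`, `latticeConnectedCorr_add_mul_period` — the torus
  time-correlation `latticeConnectedCorr ρ β L A B n` is `L`-periodic in the separation `n`
  (the periodic lift is invariant under a full time translation). Hence `corr(L) = corr(0) =
  Cov(A,B)`: the restriction `n ≤ S` in the crux conclusion (and in `HasLatticeMassGap`) is tight —
* `corr_zero_eq_zero_of_clusteringAllSep`, `not_clusteringAllSep_of_cov_lower_bound` — the
  strengthened conclusion WITHOUT `n ≤ S` forces `Cov_S(A,B) = 0` for every pair on all large tori,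
  so one pair with `|Cov_S(A,B)| ≥ v > 0` along arbitrarily large tori refutes it.
* `variance_eq_zero_of_retention_of_conserved`, `twoTimeRetention_var_eq_zero_of_conserved` — the
  two-time variance-retention inequality `ε · Var F ≤ ‖F − E[F | 𝓕_out]‖²` of the picked line
  `cyclic-peeling` (conclusion of its stub `stub_twoTimeRetention_of_slicePoincare`, hypothesis of
  `stub_peelingDecay`) forces `Var F = 0` for every admissible `F` that is a.e. a function of the
  links outside the time arc: retention is incompatible with non-trivial conserved slice
  observables (the SO(3) 't Hooft twist is one up to `O(ℓ S² e^{-cβ})`, which forces the stub's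
  `S₁(β)` beyond the monopole scale), and `retention_const_le_of_approx_conserved` quantifies it.
* `slope_eq_zero_of_discreteTopology` — for a discrete gauge group the crux's link metric slope
  (a `Filter.limsup` over `𝓝[≠] (U e) = ⊥`) is the junk value `0`, so its Dirichlet form is void:
  the statement has no content for finite `G` (excluded by `IsCompactSimpleLieGroup`).
-/

noncomputable section

namespace Summit.QuantumFields.YangMills.Theorems.PoincareToGap.Negative

open MeasureTheory Filter Topology Function
open Literature.MathematicalPhysics.QuantumFieldTheory
open Literature.MathematicalPhysics.QuantumLattice (torusLift configShift configShift_apply torusEdge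
  LGConfig)

/-! ### Periodicity of torus time-correlations -/

section Periodicity

variable {G : Type} [MeasurableSpace G] {N : ℕ}

/-- The periodic lift is invariant under a full time-translation by the period:
`τ_{(n+L)e₀} ∘ lift_L = τ_{n e₀} ∘ lift_L` on `ℤ⁴`. [folklore] -/
theorem configShift_torusLift_add_period (L n : ℕ) (U : GaugeConfig 4 L G) :
    configShift (-Pi.single 0 ((n + L : ℕ) : ℤ)) (torusLift L U) =
      configShift (-Pi.single 0 (n : ℤ)) (torusLift L U) := by
  funext e
  simp only [configShift_apply, torusLift, Function.comp_apply, torusEdge]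
  congr 2
  funext i
  simp only [Literature.Probability.LatticeModels.Torus.proj_apply, sub_neg_eq_add]
  by_cases hi : i = 0
  · subst hi
    simp [Pi.single_eq_same]
  · simp [Pi.single_eq_of_ne hi]

variable [Group G] [TopologicalSpace G] [IsTopologicalGroup G] [CompactSpace G] [BorelSpace G]

/-- **Torus time-correlations are periodic in the separation** with period the side `L`:
`corr_L(A, B, n + L) = corr_L(A, B, n)`; in particular `corr_L(A,B,L) = corr_L(A,B,0) = Cov(A,B)`.
[folklore] -/
theorem latticeConnectedCorr_add_period (ρ : G →* Matrix (Fin N) (Fin N) ℂ) (β : ℝ) (L : ℕ)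
    [NeZero L] (A B : LGConfig 4 G → ℝ) (n : ℕ) :
    latticeConnectedCorr ρ β L A B (n + L) = latticeConnectedCorr ρ β L A B n := by
  simp only [latticeConnectedCorr, configShift_torusLift_add_period]

/-- Iterated periodicity: `corr_L(A, B, n + kL) = corr_L(A, B, n)`. [folklore] -/
theorem latticeConnectedCorr_add_mul_period (ρ : G →* Matrix (Fin N) (Fin N) ℂ) (β : ℝ)
    (L : ℕ) [NeZero L] (A B : LGConfig 4 G → ℝ) (n k : ℕ) :
    latticeConnectedCorr ρ β L A B (n + k * L) = latticeConnectedCorr ρ β L A B n := by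
  induction k with
  | zero => simp
  | succ k ih => rw [Nat.succ_mul, ← add_assoc, latticeConnectedCorr_add_period, ih]

end Periodicity

/-! ### The conclusion without `n ≤ S` is false as soon as one covariance is bounded below -/

section AllSeparations

variable {G : Type} [Group G] [TopologicalSpace G] [IsTopologicalGroup G] [CompactSpace G]
  [MeasurableSpace G] [BorelSpace G]

/-- Exponential clustering at ALL separations `n` (the crux conclusion with `n ≤ S` dropped)
forces every equal-time covariance `corr_S(A, B, 0)` to vanish on all large tori: by periodicity
`|corr_S(A,B,0)| = |corr_S(A,B,k(2S+1))| ≤ C e^{-m k (2S+1)} → 0`. [folklore] -/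
theorem corr_zero_eq_zero_of_clusteringAllSep (r : LatticeRep G) (β : ℝ)
    (h : ∃ m : ℝ, 0 < m ∧ ∃ S₁ : ℕ, ∀ A B : YMSpecies G, ∃ C : ℝ, ∀ S n : ℕ, S₁ ≤ S →
      |latticeConnectedCorr r.ρ β (2 * S + 1) A.F B.F n| ≤ C * Real.exp (-(m * n))) :
    ∃ S₁ : ℕ, ∀ A B : YMSpecies G, ∀ S : ℕ, S₁ ≤ S →
      latticeConnectedCorr r.ρ β (2 * S + 1) A.F B.F 0 = 0 := by
  obtain ⟨m, hm, S₁, h⟩ := h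
  refine ⟨S₁, fun A B S hS => ?_⟩
  obtain ⟨C, hC⟩ := h A B
  have hper : ∀ k : ℕ, latticeConnectedCorr r.ρ β (2 * S + 1) A.F B.F (k * (2 * S + 1)) =
      latticeConnectedCorr r.ρ β (2 * S + 1) A.F B.F 0 := fun k => by
    simpa using latticeConnectedCorr_add_mul_period r.ρ β (2 * S + 1) A.F B.F 0 k
  have hbound : ∀ k : ℕ, |latticeConnectedCorr r.ρ β (2 * S + 1) A.F B.F 0| ≤
      C * Real.exp (-(m * ((k * (2 * S + 1) : ℕ) : ℝ))) := fun k => by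
    rw [← hper k]; exact hC S _ hS
  have hlim : Tendsto (fun k : ℕ => C * Real.exp (-(m * ((k * (2 * S + 1) : ℕ) : ℝ))))
      atTop (𝓝 (C * 0)) := by
    refine tendsto_const_nhds.mul (Real.tendsto_exp_atBot.comp ?_)
    rw [tendsto_neg_atBot_iff]
    refine Tendsto.const_mul_atTop hm (tendsto_natCast_atTop_atTop.comp ?_)
    exact tendsto_atTop_mono (fun k => Nat.le_mul_of_pos_right k (by omega)) tendsto_id
  rw [mul_zero] at hlim
  exact abs_eq_zero.mp (le_antisymm (ge_of_tendsto' hlim hbound) (abs_nonneg _))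

/-- **Tightness of `n ≤ S`.** One pair of gauge-invariant local observables whose equal-time
torus covariance satisfies `|corr_S(A,B,0)| ≥ v > 0` along arbitrarily large tori REFUTES the crux
conclusion strengthened to all separations. (For `A = B` a plaquette the lower bound is the
positivity of its variance under the full-support measure `μ_{β,S}`, uniformly in `S` by a
one-link conditional-variance bound; not formalised here.) [folklore] -/
theorem not_clusteringAllSep_of_cov_lower_bound (r : LatticeRep G) (β : ℝ) (A B : YMSpecies G)
    {v : ℝ} (hv : 0 < v)
    (hA : ∀ S₁ : ℕ, ∃ S : ℕ, S₁ ≤ S ∧ v ≤ |latticeConnectedCorr r.ρ β (2 * S + 1) A.F B.F 0|) :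
    ¬ (∃ m : ℝ, 0 < m ∧ ∃ S₁ : ℕ, ∀ A B : YMSpecies G, ∃ C : ℝ, ∀ S n : ℕ, S₁ ≤ S →
      |latticeConnectedCorr r.ρ β (2 * S + 1) A.F B.F n| ≤ C * Real.exp (-(m * n))) := fun h => by
  obtain ⟨S₁, h⟩ := corr_zero_eq_zero_of_clusteringAllSep r β h
  obtain ⟨S, hS, hvS⟩ := hA S₁
  rw [h A B S hS, abs_zero] at hvS
  exact absurd hvS (not_le.mpr hv)

end AllSeparations

/-! ### Two-time variance retention versus conserved slice observables -/

section Retention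

variable {Ω : Type*} {m m₀ : MeasurableSpace Ω} {μ : Measure Ω}

/-- **Retention kills conserved observables (abstract form).** If `F` is a.e. equal to an
`m`-measurable function then `E[F | m] = F` a.e., so the conditional variance
`‖F − E[F|m]‖²` vanishes and a retention inequality `ε · Var F ≤ ‖F − E[F|m]‖²` with `ε > 0`
forces `Var F = 0`. [folklore] -/
theorem variance_eq_zero_of_retention_of_conserved [IsFiniteMeasure μ] (hm : m ≤ m₀)
    {F : Ω → ℝ} (hF : AEStronglyMeasurable[m] F μ) (hFi : Integrable F μ) {ε : ℝ} (hε : 0 < ε)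
    (hR : ε * ∫ x, (F x - ∫ y, F y ∂μ) ^ 2 ∂μ ≤ ∫ x, (F x - (μ[F|m]) x) ^ 2 ∂μ) :
    ∫ x, (F x - ∫ y, F y ∂μ) ^ 2 ∂μ = 0 := by
  have hae : μ[F|m] =ᵐ[μ] F := condExp_of_aestronglyMeasurable' hm hF hFi
  have h0 : ∫ x, (F x - (μ[F|m]) x) ^ 2 ∂μ = 0 := by
    have : (fun x => (F x - (μ[F|m]) x) ^ 2) =ᵐ[μ] fun _ => (0 : ℝ) := by
      filter_upwards [hae] with x hx
      simp [hx]
    rw [integral_congr_ae this, integral_zero]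
  have hnn : 0 ≤ ∫ x, (F x - ∫ y, F y ∂μ) ^ 2 ∂μ := integral_nonneg fun _ => sq_nonneg _
  rw [h0] at hR
  nlinarith [mul_nonneg hε.le hnn]

omit [m : MeasurableSpace Ω] in
/-- **Approximate conservation bounds the retention constant:** `ε · V ≤ R ≤ η` and
`V ≥ v > 0` give `ε ≤ η / v`. (SO(3) twist across an arc of length `ℓ`: `η ≲ ℓ (2S+1)² e^{-cβ}`,
`v ≈ 1/4`.) [folklore] -/
theorem retention_const_le_of_approx_conserved {V R ε η v : ℝ} (hR : ε * V ≤ R) (hη : R ≤ η)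
    (hv : v ≤ V) (hv0 : 0 < v) (hε : 0 ≤ ε) : ε ≤ η / v := by
  rw [le_div_iff₀ hv0]
  calc ε * v ≤ ε * V := mul_le_mul_of_nonneg_left hv hε
    _ ≤ η := hR.trans hη

end Retention

section RetentionStub

variable {G : Type} [Group G] [TopologicalSpace G] [IsTopologicalGroup G] [CompactSpace G]
  [MeasurableSpace G] [BorelSpace G]

/-- **In the syntax of the picked line.** Hypothesis `h` is verbatim the body of the conclusion
of `stub_twoTimeRetention_of_slicePoincare` (= the retention hypothesis of `stub_peelingDecay`)
on the torus of side `2S+1` with constant `ε > 0`. Then every admissible two-slice observable `F`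
(measurable, bounded, gauge-invariant, depending on the spatial links of the slices `s` and
`s+ℓ-1`) which is a.e. equal to a function of the links OUTSIDE the arc `[s, s+ℓ-1]` — a
conserved slice quantity — has variance zero under the torus Wilson measure. A non-trivial
conserved bounded gauge-invariant slice observable at `(β, S)` would refute retention at `S`.
[folklore] -/
theorem twoTimeRetention_var_eq_zero_of_conserved (r : LatticeRep G) {β ε : ℝ} {S : ℕ}
    (h : ∀ μ : Measure (GaugeConfig 4 (2 * S + 1) G),
      μ = (wilsonMeasure r.ρ β : Measure (GaugeConfig 4 (2 * S + 1) G)) →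
      ∀ (s : ZMod (2 * S + 1)) (ℓ : ℕ), 3 ≤ ℓ → ℓ + 3 ≤ 2 * S + 1 →
      ∀ F : GaugeConfig 4 (2 * S + 1) G → ℝ, Measurable F → (∃ M : ℝ, ∀ U, |F U| ≤ M) →
      IsGaugeInvariant F →
      DependsOn F {e : Edge 4 (2 * S + 1) | ((e.1 0 - s).val = 0 ∨ (e.1 0 - s).val = ℓ - 1) ∧
        e.2 ≠ 0} →
      ε * ∫ U, (F U - ∫ V, F V ∂μ) ^ 2 ∂μ ≤
        ∫ U, (F U - condExp (cylinderEvents {e : Edge 4 (2 * S + 1) | ℓ ≤ (e.1 0 - s).val}) μ F U)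
          ^ 2 ∂μ)
    (hε : 0 < ε) (s : ZMod (2 * S + 1)) (ℓ : ℕ) (h3 : 3 ≤ ℓ) (hℓ : ℓ + 3 ≤ 2 * S + 1)
    (F : GaugeConfig 4 (2 * S + 1) G → ℝ) (hFm : Measurable F) (hFb : ∃ M : ℝ, ∀ U, |F U| ≤ M)
    (hFg : IsGaugeInvariant F)
    (hFd : DependsOn F {e : Edge 4 (2 * S + 1) |
      ((e.1 0 - s).val = 0 ∨ (e.1 0 - s).val = ℓ - 1) ∧ e.2 ≠ 0})
    (hcons : AEStronglyMeasurable[cylinderEvents {e : Edge 4 (2 * S + 1) | ℓ ≤ (e.1 0 - s).val}]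
      F (wilsonMeasure (d := 4) (L := 2 * S + 1) r.ρ β)) :
    ∫ U, (F U - ∫ V, F V ∂(wilsonMeasure (d := 4) (L := 2 * S + 1) r.ρ β)) ^ 2
      ∂(wilsonMeasure (d := 4) (L := 2 * S + 1) r.ρ β) = 0 := by
  haveI := isProbabilityMeasure_wilsonMeasure (d := 4) (L := 2 * S + 1) r.ρ r.continuous β
  obtain ⟨M, hM⟩ := hFb
  have hFi : Integrable F (wilsonMeasure (d := 4) (L := 2 * S + 1) r.ρ β) :=
    Integrable.of_bound hFm.aestronglyMeasurable M (Eventually.of_forall fun U => by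
      simpa [Real.norm_eq_abs] using hM U)
  exact variance_eq_zero_of_retention_of_conserved cylinderEvents_le_pi hcons hFi hε
    (h _ rfl s ℓ h3 hℓ F hFm ⟨M, hM⟩ hFg hFd)

end RetentionStub

/-! ### Discrete gauge groups: the link metric slope is junk-zero -/

section Discrete

variable {G : Type} [Group G] [TopologicalSpace G]

/-- For a DISCRETE `G` every point is isolated, `𝓝[≠] (U e) = ⊥`, and the `Filter.limsup` in the
crux's metric slope `|∇_e f|(U)` is the junk value `sInf univ = 0`: the equal-time Dirichlet form
of the crux is void for finite gauge groups (which `IsCompactSimpleLieGroup` excludes via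
connectedness), so the hypothesis degenerates to `Var f ≤ 0` there. [folklore] -/
theorem slope_eq_zero_of_discreteTopology [DiscreteTopology G] (r : LatticeRep G) (S : ℕ)
    (f : GaugeConfig 4 (2 * S + 1) G → ℝ) (U : GaugeConfig 4 (2 * S + 1) G)
    (e : Edge 4 (2 * S + 1)) :
    Filter.limsup (fun g : G => |f (Function.update U e g) - f U| /
      Real.sqrt (∑ a, ∑ b, ‖(r.ρ g - r.ρ (U e)) a b‖ ^ 2)) (𝓝[≠] (U e)) = 0 := by
  have hbot : 𝓝[≠] (U e) = ⊥ := (discreteTopology_iff_nhds_ne.mp ‹_›) (U e)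
  simp [hbot, Filter.limsup, Filter.limsSup]

end Discrete

end Summit.QuantumFields.YangMills.Theorems.PoincareToGap.Negative

end
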